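import Literature.MathematicalPhysics.QuantumFieldTheory.Balaban1983to89.T3MinimiserStabilityReduction
import Literature.MathematicalPhysics.QuantumFieldTheory.Balaban1983to89.T3PrintedRegularMinimiser
import Literature.MathematicalPhysics.QuantumFieldTheory.Balaban1983to89.T3UnitLawDensityEML
import HarnessLib

/-!
# PATH-B CERTIFICATE, FILE 1 (P-B1): THE S2 STAGE TABLE OF THE RUN-PAIR ORGAN AS A THEOREMS THEOREM
# `RunPairSeed` ⟸ S2α′ `ClassicalPerHeight` ∧ S2β `FluctuationPartSmall` — def-free port of `Lines/runpair_organ.lean` v15 :326–:603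

width seat `ym3-torus-px21` (gen 12); helper `--supports stmt-QuantumFields-20520`; count-neutral.  THEOREMS ONLY (0 `def`, 0 `sorry`, default
heartbeats).  ★★OWNER WORD 91 «PATH-B CERTIFICATE»: the ideator's run-pair organ (`Cruxes/FluctuationComparisonRegPrIntL/Lines/runpair_organ.lean`
v15, tree 0650791df513275d) closes the R3 LEAF `YM3TorusSU2` BY NAME from the registered rows {S1a, 26243, S2α′, S2β, O1} — as a Cruxes-level
workfile.  This file ports, VERBATIM and def-free, the part of that kernel composition which exists ONLY in the Cruxes file: the S2 STAGE TABLE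
(v6, LINE g15-2) — S2 `RunPairSeed` (text v15, p₀-thresholded) from S2α′ `ClassicalPerHeight` (v9) and S2β `FluctuationPartSmall` (v15) through
the organ's PROVED glue `classicalTwoDepth_of_perHeight`, `diagonalSchedule` / `diagonalScheduleStrict` and `runPairSeed_of_table`.  Every organ
text is displayed as a binder / conclusion BYTE-FOR-BYTE (the organ's `def`s are not importable from `Theorems/`); every proof is the Cruxes file's
proof.  FILE 2 (P-B2, the leaf `ym3TorusSU2_of_runPairOrganRows (hS1a) (h26243) (hS2α′) (hS2β) (hO1)`) imports this file and the landed Theorems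
copies of S1b's door, FC and S4a–c.

HONEST: glue only — S2α′, S2β (and S1a, 26243, O1) are NOT proved here or anywhere; the R3 leaf is NOT proved; rung R3 = SU(2) YM₃ on T³ —
NOT d = 4, NOT infinite volume, NOT a mass gap, NOT Clay.
-/

set_option autoImplicit false

open MeasureTheory Filter Topology
open Literature.MathematicalPhysics.QuantumFieldTheory.Balaban1983to89 T3ContinuumYM3Torus T3NestedUnitLaws
  T3UnitLawDensityEML T4Continuum T3UnitScaleTilt T3PrintedRegularMinimiser

namespace Summit.QuantumFields.YangMills.Theorems.FluctuationComparisonRegPrIntL.RunPairOrgan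

/-! ## §1 S2α′ ⇒ S2α (organ v9 glue) -/

/-- ★★ **CLASSICAL TWO-DEPTH EQUILIBRATION FROM ITS PLAIN PER-HEIGHT FORM** (organ `classicalTwoDepth_of_perHeight`, v9; hypothesis = S2α′
`ClassicalPerHeight` VERBATIM, conclusion = S2α `ClassicalTwoDepth` VERBATIM): tail suprema `Ā_J n := sup_{k ≥ n} A_J k`, weights
`c J := 2^{-J}/(Ā_J 0 + 1)`, the summed antitone null rate `τ n := Σ_J c J · Ā_J n` (dominated convergence), height profile `P J := e^{D_J}/c J`
with `D_J` the finite `tdist`-diameter of `PBond (F.P J) 0` (absorbs the clustering factor, `κ := 1`).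
[cite: Balaban1985Variational, Thm 1; Balaban1985PropagatorsII, (1.33)] -/
theorem classicalTwoDepth_of_perHeight
    (h :
      ∀ (L : ℕ) (b₀ p₀ : ℝ), 0 < b₀ → 0 < p₀ → ∃ ε₁ : ℝ, 0 < ε₁ ∧ ∀ (ε₀ : ℝ), 0 < ε₀ → ε₀ ≤ ε₁ →
        ∃ γ₁ : ℝ, 0 < γ₁ ∧ ∀ (F : T3Family) (γ : ℝ), F.L = L → 0 < γ → γ ≤ γ₁ →
          ∀ J : ℕ, ∃ A : ℕ → ℝ, (∀ n, 0 ≤ A n) ∧ Tendsto A atTop (𝓝 0) ∧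
            ∀ (K K' : ℕ) (hJK : J ≤ K) (hJK' : J ≤ K'), K ≤ K' →
              ∀ (b b' : PBond (F.P J) 0) (U V W Z : GaugeField (F.P J) 0 (Matrix.specialUnitaryGroup (Fin 2) ℂ)),
                PlaqSmall (θBal F.L γ b₀ p₀ J) U → PlaqSmall (θBal F.L γ b₀ p₀ J) V →
                PlaqSmall (θBal F.L γ b₀ p₀ J) W → PlaqSmall (θBal F.L γ b₀ p₀ J) Z →
                (∀ e, e ≠ b → U e = V e) → (∀ e, e ≠ b' → U e = W e) → (∀ e, e ≠ b' → V e = Z e) → (∀ e, e ≠ b → W e = Z e) →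
                |((F.scheme ℰp γ).β K * minActionRegPr F J K hJK ε₀ U - (F.scheme ℰp γ).β K' * minActionRegPr F J K' hJK' ε₀ U)
                  - ((F.scheme ℰp γ).β K * minActionRegPr F J K hJK ε₀ V - (F.scheme ℰp γ).β K' * minActionRegPr F J K' hJK' ε₀ V)
                  - (((F.scheme ℰp γ).β K * minActionRegPr F J K hJK ε₀ W - (F.scheme ℰp γ).β K' * minActionRegPr F J K' hJK' ε₀ W)
                    - ((F.scheme ℰp γ).β K * minActionRegPr F J K hJK ε₀ Z - (F.scheme ℰp γ).β K' * minActionRegPr F J K' hJK' ε₀ Z))|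
                  ≤ A (K - J)) :
    ∀ (L : ℕ) (b₀ p₀ : ℝ), 0 < b₀ → 0 < p₀ → ∃ ε₁ : ℝ, 0 < ε₁ ∧ ∀ (ε₀ : ℝ), 0 < ε₀ → ε₀ ≤ ε₁ →
      ∃ γ₁ : ℝ, 0 < γ₁ ∧ ∃ κ : ℝ, 0 < κ ∧ ∀ (F : T3Family) (γ : ℝ), F.L = L → 0 < γ → γ ≤ γ₁ →
        ∃ (P τ : ℕ → ℝ), (∀ n, 0 ≤ P n) ∧ (∀ n, 0 ≤ τ n) ∧ Antitone τ ∧ Tendsto τ atTop (𝓝 0) ∧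
          ∀ (J K K' : ℕ) (hJK : J ≤ K) (hJK' : J ≤ K'), K ≤ K' →
            ∀ (b b' : PBond (F.P J) 0) (U V W Z : GaugeField (F.P J) 0 (Matrix.specialUnitaryGroup (Fin 2) ℂ)),
              PlaqSmall (θBal F.L γ b₀ p₀ J) U → PlaqSmall (θBal F.L γ b₀ p₀ J) V →
              PlaqSmall (θBal F.L γ b₀ p₀ J) W → PlaqSmall (θBal F.L γ b₀ p₀ J) Z →
              (∀ e, e ≠ b → U e = V e) → (∀ e, e ≠ b' → U e = W e) → (∀ e, e ≠ b' → V e = Z e) → (∀ e, e ≠ b → W e = Z e) →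
              |((F.scheme ℰp γ).β K * minActionRegPr F J K hJK ε₀ U - (F.scheme ℰp γ).β K' * minActionRegPr F J K' hJK' ε₀ U)
                - ((F.scheme ℰp γ).β K * minActionRegPr F J K hJK ε₀ V - (F.scheme ℰp γ).β K' * minActionRegPr F J K' hJK' ε₀ V)
                - (((F.scheme ℰp γ).β K * minActionRegPr F J K hJK ε₀ W - (F.scheme ℰp γ).β K' * minActionRegPr F J K' hJK' ε₀ W)
                  - ((F.scheme ℰp γ).β K * minActionRegPr F J K hJK ε₀ Z - (F.scheme ℰp γ).β K' * minActionRegPr F J K' hJK' ε₀ Z))|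
                ≤ P J * τ (K - J) * Real.exp (-(κ * (b.src.tdist b'.src : ℝ))) := by
  classical
  intro L b₀ p₀ hb₀ hp₀
  obtain ⟨ε₁, hε₁, H⟩ := h L b₀ p₀ hb₀ hp₀
  refine ⟨ε₁, hε₁, fun ε₀ hε₀ hε₀1 => ?_⟩
  obtain ⟨γ₁, hγ₁, H⟩ := H ε₀ hε₀ hε₀1
  refine ⟨γ₁, hγ₁, 1, one_pos, fun F γ hFL hγ hγ1 => ?_⟩
  have HJ := H F γ hFL hγ hγ1
  choose A hA0 hAt hAb using HJ
  -- tail suprema Ā J n := sup_{k ≥ n} A J k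
  have hbdd : ∀ J n, BddAbove (A J '' Set.Ici n) := fun J n =>
    (hAt J).bddAbove_range.mono (Set.image_subset_range _ _)
  have hne : ∀ J n, (A J '' Set.Ici n).Nonempty := fun J n => ⟨A J n, n, Set.mem_Ici.2 le_rfl, rfl⟩
  let Ab : ℕ → ℕ → ℝ := fun J n => sSup (A J '' Set.Ici n)
  have hA_le : ∀ J n k, n ≤ k → A J k ≤ Ab J n := fun J n k hk => le_csSup (hbdd J n) ⟨k, Set.mem_Ici.2 hk, rfl⟩
  have hAb_le : ∀ J n (c : ℝ), (∀ k, n ≤ k → A J k ≤ c) → Ab J n ≤ c := fun J n c hc =>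
    csSup_le (hne J n) (by rintro _ ⟨k, hk, rfl⟩; exact hc k (Set.mem_Ici.1 hk))
  have hAb0 : ∀ J n, 0 ≤ Ab J n := fun J n => (hA0 J n).trans (hA_le J n n le_rfl)
  have hAb_anti : ∀ J, Antitone (Ab J) := fun J n m hnm =>
    hAb_le J m _ (fun k hk => hA_le J n k (hnm.trans hk))
  have hAb_t : ∀ J, Tendsto (Ab J) atTop (𝓝 0) := by
    intro J
    rw [Metric.tendsto_atTop]
    intro e he
    obtain ⟨N, hN⟩ := (Metric.tendsto_atTop.1 (hAt J)) (e / 2) (half_pos he)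
    refine ⟨N, fun n hn => ?_⟩
    rw [Real.dist_eq, sub_zero, abs_of_nonneg (hAb0 J n)]
    have : Ab J n ≤ e / 2 := hAb_le J n _ (fun k hk => by
      have h := hN k (hn.trans hk)
      rw [Real.dist_eq, sub_zero] at h
      exact (le_abs_self _).trans h.le)
    linarith
  -- weights and the summed rate
  let c : ℕ → ℝ := fun J => ((1 : ℝ) / 2) ^ J / (Ab J 0 + 1)
  have hc0 : ∀ J, 0 < c J := fun J => div_pos (pow_pos (by norm_num) J) (by linarith [hAb0 J 0])
  have hterm0 : ∀ J n, 0 ≤ c J * Ab J n := fun J n => mul_nonneg (hc0 J).le (hAb0 J n)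
  have hterm_le : ∀ J n, c J * Ab J n ≤ ((1 : ℝ) / 2) ^ J := by
    intro J n
    have h1 : Ab J n ≤ Ab J 0 + 1 := (hAb_anti J (Nat.zero_le n)).trans (by linarith)
    have h2 : Ab J n / (Ab J 0 + 1) ≤ 1 := (div_le_one (by linarith [hAb0 J 0])).2 h1
    calc c J * Ab J n = ((1 : ℝ) / 2) ^ J * (Ab J n / (Ab J 0 + 1)) := by
            show ((1 : ℝ) / 2) ^ J / (Ab J 0 + 1) * Ab J n = _; ring
      _ ≤ ((1 : ℝ) / 2) ^ J * 1 := mul_le_mul_of_nonneg_left h2 (pow_nonneg (by norm_num) J)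
      _ = ((1 : ℝ) / 2) ^ J := mul_one _
  have hgeom : Summable (fun J : ℕ => ((1 : ℝ) / 2) ^ J) :=
    summable_geometric_of_lt_one (by norm_num) (by norm_num)
  have hsum : ∀ n, Summable (fun J => c J * Ab J n) := fun n =>
    Summable.of_nonneg_of_le (fun J => hterm0 J n) (fun J => hterm_le J n) hgeom
  let τ : ℕ → ℝ := fun n => ∑' J, c J * Ab J n
  have hτ0 : ∀ n, 0 ≤ τ n := fun n => tsum_nonneg (fun J => hterm0 J n)
  have hτa : Antitone τ := fun n m hnm =>
    Summable.tsum_le_tsum (fun J => mul_le_mul_of_nonneg_left (hAb_anti J hnm) (hc0 J).le) (hsum m) (hsum n)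
  have hτt : Tendsto τ atTop (𝓝 0) := by
    have h := tendsto_tsum_of_dominated_convergence (f := fun n J => c J * Ab J n) (g := fun _ => (0 : ℝ))
      (bound := fun J => ((1 : ℝ) / 2) ^ J) hgeom
      (fun J => by simpa using (hAb_t J).const_mul (c J))
      (Eventually.of_forall fun n J => by rw [Real.norm_eq_abs, abs_of_nonneg (hterm0 J n)]; exact hterm_le J n)
    simpa using h
  have hτ_ge : ∀ J n, c J * Ab J n ≤ τ n := fun J n =>
    (hsum n).le_tsum J (fun i _ => hterm0 i n)
  -- finite diameter of the bond set at each height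
  have hDm : ∀ J, ∃ Dm : ℝ, ∀ b b' : PBond (F.P J) 0, (b.src.tdist b'.src : ℝ) ≤ Dm := by
    intro J
    obtain ⟨M, hM⟩ := Finite.exists_le (fun q : PBond (F.P J) 0 × PBond (F.P J) 0 => (q.1.src.tdist q.2.src : ℝ))
    exact ⟨M, fun b b' => hM (b, b')⟩
  choose Dm hDm using hDm
  refine ⟨fun J => Real.exp (Dm J) / c J, τ, fun J => (div_pos (Real.exp_pos _) (hc0 J)).le, hτ0, hτa, hτt, ?_⟩
  intro J K K' hJK hJK' hKK' b b' U V W Z hU hV hW hZ h1 h2 h3 h4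
  have hD := hAb J K K' hJK hJK' hKK' b b' U V W Z hU hV hW hZ h1 h2 h3 h4
  refine hD.trans ?_
  have step1 : A J (K - J) ≤ Ab J (K - J) := hA_le J _ _ le_rfl
  have step2 : Ab J (K - J) ≤ τ (K - J) / c J := by
    rw [le_div_iff₀ (hc0 J), mul_comm]; exact hτ_ge J _
  have step3 : Real.exp (-(Dm J)) ≤ Real.exp (-(1 * (b.src.tdist b'.src : ℝ))) :=
    Real.exp_le_exp.2 (by rw [one_mul]; exact neg_le_neg (hDm J b b'))
  have hE : Real.exp (Dm J) * Real.exp (-(Dm J)) = 1 := by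
    rw [← Real.exp_add, add_neg_cancel, Real.exp_zero]
  have hnn : 0 ≤ Real.exp (Dm J) / c J * τ (K - J) :=
    mul_nonneg (div_pos (Real.exp_pos _) (hc0 J)).le (hτ0 _)
  calc A J (K - J) ≤ τ (K - J) / c J := step1.trans step2
    _ = Real.exp (Dm J) / c J * τ (K - J) * Real.exp (-(Dm J)) := by
        rw [show Real.exp (Dm J) / c J * τ (K - J) * Real.exp (-(Dm J))
            = τ (K - J) / c J * (Real.exp (Dm J) * Real.exp (-(Dm J))) by ring, hE, mul_one]
    _ ≤ Real.exp (Dm J) / c J * τ (K - J) * Real.exp (-(1 * (b.src.tdist b'.src : ℝ))) :=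
        mul_le_mul_of_nonneg_left step3 hnn

/-! ## §2 The diagonal schedules (pure real analysis, organ v6/v8) -/

/-- **DIAGONAL SCHEDULE** (organ `diagonalSchedule`): along a height schedule `J K → ∞` with `J K ≤ K`, ANY profile `f ≥ 0` evaluated at `J K`
times an antitone null sequence evaluated at the depth `K − J K` is `o(1)` after the factor `J K`. [folklore] -/
theorem diagonalSchedule (f τ : ℕ → ℝ) (hf : ∀ n, 0 ≤ f n) (hτ0 : ∀ n, 0 ≤ τ n) (hτa : Antitone τ)
    (hτ : Tendsto τ atTop (𝓝 0)) :
    ∃ J : ℕ → ℕ, (∀ K, J K ≤ K) ∧ Tendsto J atTop atTop ∧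
      Tendsto (fun K => (J K : ℝ) * (f (J K) + 1) * τ (K - J K)) atTop (𝓝 0) := by
  classical
  -- envelope of `f` up to `N` and the budget `g N`
  let S : ℕ → ℝ := fun N => ∑ n ∈ Finset.range (N + 1), f n
  have hSf : ∀ N, f N ≤ S N := fun N =>
    Finset.single_le_sum (f := f) (fun n _ => hf n) (Finset.self_mem_range_succ N)
  have hS0 : ∀ N, 0 ≤ S N := fun N => Finset.sum_nonneg fun n _ => hf n
  let g : ℕ → ℝ := fun N => ((N : ℝ) + 1) ^ 2 * (S N + 1)
  have hg : ∀ N, 0 < g N := fun N =>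
    mul_pos (pow_pos (by positivity) 2) (by linarith [hS0 N])
  have hex : ∀ N, ∃ n, τ n ≤ 1 / g N := fun N => by
    have h := (hτ.eventually (gt_mem_nhds (one_div_pos.2 (hg N)))).exists
    obtain ⟨n, hn⟩ := h
    exact ⟨n, hn.le⟩
  let nN : ℕ → ℕ := fun N => Nat.find (hex N)
  have hnN : ∀ N, τ (nN N) ≤ 1 / g N := fun N => Nat.find_spec (hex N)
  let J : ℕ → ℕ := fun K => Nat.findGreatest (fun N => nN N + N ≤ K) K
  refine ⟨J, fun K => Nat.findGreatest_le K, ?_, ?_⟩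
  · refine tendsto_atTop_atTop.2 fun N => ⟨nN N + N, fun K hK => ?_⟩
    exact Nat.le_findGreatest (le_trans (Nat.le_add_left N (nN N)) hK) hK
  · have hbound : ∀ K, (J K : ℝ) * (f (J K) + 1) * τ (K - J K) ≤ 1 / ((J K : ℝ) + 1) := by
      intro K
      by_cases h0 : J K = 0
      · rw [h0]; simp
      · have hP : nN (J K) + J K ≤ K := (Nat.findGreatest_eq_iff.1 rfl).2.1 h0
        have hdepth : nN (J K) ≤ K - J K := by omega
        have hτle : τ (K - J K) ≤ 1 / g (J K) := le_trans (hτa hdepth) (hnN (J K))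
        have hN0 : (0 : ℝ) ≤ J K := Nat.cast_nonneg _
        have hf1 : 0 ≤ f (J K) + 1 := by linarith [hf (J K)]
        calc (J K : ℝ) * (f (J K) + 1) * τ (K - J K)
            ≤ (J K : ℝ) * (f (J K) + 1) * (1 / g (J K)) :=
              mul_le_mul_of_nonneg_left hτle (mul_nonneg hN0 hf1)
          _ = (J K : ℝ) * ((f (J K) + 1) / (S (J K) + 1)) / ((J K : ℝ) + 1) ^ 2 := by
              simp only [g]; field_simp
          _ ≤ (J K : ℝ) * 1 / ((J K : ℝ) + 1) ^ 2 := by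
              gcongr
              · exact (div_le_one (by linarith [hS0 (J K)])).2 (by linarith [hSf (J K)])
          _ ≤ 1 / ((J K : ℝ) + 1) := by
              rw [div_le_div_iff₀ (by positivity) (by positivity)]
              nlinarith
    have hnonneg : ∀ K, 0 ≤ (J K : ℝ) * (f (J K) + 1) * τ (K - J K) := fun K =>
      mul_nonneg (mul_nonneg (Nat.cast_nonneg _) (by linarith [hf (J K)])) (hτ0 _)
    have hJ : Tendsto J atTop atTop := by
      refine tendsto_atTop_atTop.2 fun N => ⟨nN N + N, fun K hK => ?_⟩
      exact Nat.le_findGreatest (le_trans (Nat.le_add_left N (nN N)) hK) hK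
    have hlim : Tendsto (fun K => 1 / ((J K : ℝ) + 1)) atTop (𝓝 0) :=
      tendsto_one_div_add_atTop_nhds_zero_nat.comp hJ
    exact squeeze_zero hnonneg hbound hlim

/-- **STRICT DIAGONAL SCHEDULE** (organ `diagonalScheduleStrict`, v8): as `diagonalSchedule` with `J K < K` for `1 ≤ K` (the seed height strictly
below the cut-off, so that the finite backward chain starts one height above the seed). [folklore] -/
theorem diagonalScheduleStrict (f τ : ℕ → ℝ) (hf : ∀ n, 0 ≤ f n) (hτ0 : ∀ n, 0 ≤ τ n) (hτa : Antitone τ)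
    (hτ : Tendsto τ atTop (𝓝 0)) :
    ∃ J : ℕ → ℕ, (∀ K, 1 ≤ K → J K < K) ∧ (∀ K, J K ≤ K) ∧ Tendsto J atTop atTop ∧
      Tendsto (fun K => (J K : ℝ) * (f (J K) + 1) * τ (K - J K)) atTop (𝓝 0) := by
  obtain ⟨J, hJle, hJ, hprod⟩ := diagonalSchedule f τ hf hτ0 hτa hτ
  refine ⟨fun K => J (K - 1), fun K hK => lt_of_le_of_lt (hJle (K - 1)) (Nat.sub_lt hK one_pos),
    fun K => (hJle _).trans (Nat.sub_le K 1), hJ.comp (tendsto_sub_atTop_nat 1), ?_⟩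
  have h := hprod.comp (tendsto_sub_atTop_nat 1)
  refine squeeze_zero' (Eventually.of_forall fun K => ?_) (Eventually.of_forall fun K => ?_) h
  · exact mul_nonneg (mul_nonneg (Nat.cast_nonneg _) (by linarith [hf (J (K - 1))])) (hτ0 _)
  · show (J (K - 1) : ℝ) * (f (J (K - 1)) + 1) * τ (K - J (K - 1)) ≤
        (J (K - 1) : ℝ) * (f (J (K - 1)) + 1) * τ (K - 1 - J (K - 1))
    exact mul_le_mul_of_nonneg_left (hτa (Nat.sub_le_sub_right (Nat.sub_le K 1) _))
      (mul_nonneg (Nat.cast_nonneg _) (by linarith [hf (J (K - 1))]))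

/-! ## §3 The seed from the two tables (organ v6/v9/v15) -/

/-- ★★★ **RUN-PAIR SEED FROM THE S2 STAGE TABLE** (organ `runPairSeed_of_table ∘ classicalTwoDepth_of_perHeight`; hypotheses = S2α′
`ClassicalPerHeight` (v9) and S2β `FluctuationPartSmall` (v15, p₀-thresholded) VERBATIM, conclusion = S2 `RunPairSeed` (v15) VERBATIM — the `h2`
input of the organ's `unitLawCauchy_perL_of` from two of the five registered rows): at the adaptive height `J K` of the strict diagonal schedule the
two runs' window log-densities differ by the tree-level two-depth discrepancy `P(J K)·τ(K − J K)` plus two fluctuation parts `2φ(J K)`, all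
κ-clustered; `J K·σ K → 0` by `diagonalScheduleStrict` and `J·φ J → 0`. [cite: Balaban1985UV3, (41) p.266; Balaban1985Variational, Thm 1] -/
theorem runPairSeed_of_tables
    (hα' :
      ∀ (L : ℕ) (b₀ p₀ : ℝ), 0 < b₀ → 0 < p₀ → ∃ ε₁ : ℝ, 0 < ε₁ ∧ ∀ (ε₀ : ℝ), 0 < ε₀ → ε₀ ≤ ε₁ →
        ∃ γ₁ : ℝ, 0 < γ₁ ∧ ∀ (F : T3Family) (γ : ℝ), F.L = L → 0 < γ → γ ≤ γ₁ →
          ∀ J : ℕ, ∃ A : ℕ → ℝ, (∀ n, 0 ≤ A n) ∧ Tendsto A atTop (𝓝 0) ∧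
            ∀ (K K' : ℕ) (hJK : J ≤ K) (hJK' : J ≤ K'), K ≤ K' →
              ∀ (b b' : PBond (F.P J) 0) (U V W Z : GaugeField (F.P J) 0 (Matrix.specialUnitaryGroup (Fin 2) ℂ)),
                PlaqSmall (θBal F.L γ b₀ p₀ J) U → PlaqSmall (θBal F.L γ b₀ p₀ J) V →
                PlaqSmall (θBal F.L γ b₀ p₀ J) W → PlaqSmall (θBal F.L γ b₀ p₀ J) Z →
                (∀ e, e ≠ b → U e = V e) → (∀ e, e ≠ b' → U e = W e) → (∀ e, e ≠ b' → V e = Z e) → (∀ e, e ≠ b → W e = Z e) →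
                |((F.scheme ℰp γ).β K * minActionRegPr F J K hJK ε₀ U - (F.scheme ℰp γ).β K' * minActionRegPr F J K' hJK' ε₀ U)
                  - ((F.scheme ℰp γ).β K * minActionRegPr F J K hJK ε₀ V - (F.scheme ℰp γ).β K' * minActionRegPr F J K' hJK' ε₀ V)
                  - (((F.scheme ℰp γ).β K * minActionRegPr F J K hJK ε₀ W - (F.scheme ℰp γ).β K' * minActionRegPr F J K' hJK' ε₀ W)
                    - ((F.scheme ℰp γ).β K * minActionRegPr F J K hJK ε₀ Z - (F.scheme ℰp γ).β K' * minActionRegPr F J K' hJK' ε₀ Z))|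
                  ≤ A (K - J))
    (hβ :
      ∀ (L : ℕ), ∃ pS : ℝ, ∀ (b₀ p₀ : ℝ), 0 < b₀ → pS ≤ p₀ → 0 < p₀ → ∃ ε₁ : ℝ, 0 < ε₁ ∧ ∀ (ε₀ : ℝ), 0 < ε₀ → ε₀ ≤ ε₁ →
        ∃ γ₁ : ℝ, 0 < γ₁ ∧ ∃ κ : ℝ, 0 < κ ∧ ∀ (F : T3Family) (γ : ℝ), F.L = L → 0 < γ → γ ≤ γ₁ →
          ∃ (φ : ℕ → ℝ), (∀ J, 0 ≤ φ J) ∧ Tendsto (fun J : ℕ => (J : ℝ) * φ J) atTop (𝓝 0) ∧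
            ∀ (ν : ℕ → (j : ℕ) → Measure (GaugeField (F.P j) 0 (Matrix.specialUnitaryGroup (Fin 2) ℂ))),
              (∀ K, ν K K = T4GenFunBounds.gibbsMeasure (F.P K) ((F.scheme ℰp γ).β K)) →
              (∀ K j, j < K → ν K j = Measure.map (descend F ℰp j) (ν K (j + 1))) →
              ∀ (J K : ℕ) (hJK : J ≤ K) (ρ : GaugeField (F.P J) 0 (Matrix.specialUnitaryGroup (Fin 2) ℂ) → ℝ),
                (∀ U, PlaqSmall (θBal F.L γ b₀ p₀ J) U → 0 < ρ U) →
                ν K J = (fieldMeasure _ _ _).withDensity (fun U => ENNReal.ofReal (ρ U)) →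
                ContinuousOn ρ {U | PlaqSmall (θBal F.L γ b₀ p₀ J) U} →
                ∀ (b b' : PBond (F.P J) 0) (U V W Z : GaugeField (F.P J) 0 (Matrix.specialUnitaryGroup (Fin 2) ℂ)),
                  PlaqSmall (θBal F.L γ b₀ p₀ J) U → PlaqSmall (θBal F.L γ b₀ p₀ J) V →
                  PlaqSmall (θBal F.L γ b₀ p₀ J) W → PlaqSmall (θBal F.L γ b₀ p₀ J) Z →
                  (∀ e, e ≠ b → U e = V e) → (∀ e, e ≠ b' → U e = W e) → (∀ e, e ≠ b' → V e = Z e) → (∀ e, e ≠ b → W e = Z e) →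
                  |((Real.log (ρ U) + (F.scheme ℰp γ).β K * minActionRegPr F J K hJK ε₀ U)
                      - (Real.log (ρ V) + (F.scheme ℰp γ).β K * minActionRegPr F J K hJK ε₀ V))
                    - ((Real.log (ρ W) + (F.scheme ℰp γ).β K * minActionRegPr F J K hJK ε₀ W)
                      - (Real.log (ρ Z) + (F.scheme ℰp γ).β K * minActionRegPr F J K hJK ε₀ Z))|
                    ≤ φ J * Real.exp (-(κ * (b.src.tdist b'.src : ℝ)))) :
    ∀ (L : ℕ), ∃ pS : ℝ, ∀ (b₀ p₀ : ℝ), 0 < b₀ → pS ≤ p₀ → 0 < p₀ → ∃ γ₁ : ℝ, 0 < γ₁ ∧ ∃ κ : ℝ, 0 < κ ∧ ∀ (F : T3Family) (γ : ℝ), F.L = L → 0 < γ → γ ≤ γ₁ →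
      ∃ (J : ℕ → ℕ) (σ : ℕ → ℝ), (∀ K, 1 ≤ K → J K < K) ∧ (∀ K, J K ≤ K) ∧ Tendsto J atTop atTop ∧ (∀ K, 0 ≤ σ K) ∧
        Tendsto σ atTop (𝓝 0) ∧
        Tendsto (fun K => (J K : ℝ) * σ K) atTop (𝓝 0) ∧
        ∀ (ν : ℕ → (j : ℕ) → Measure (GaugeField (F.P j) 0 (Matrix.specialUnitaryGroup (Fin 2) ℂ))),
          (∀ K, ν K K = T4GenFunBounds.gibbsMeasure (F.P K) ((F.scheme ℰp γ).β K)) →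
          (∀ K j, j < K → ν K j = Measure.map (descend F ℰp j) (ν K (j + 1))) →
          ∀ (K K' : ℕ), K ≤ K' → ∀ (ρ₁ ρ₂ : GaugeField (F.P (J K)) 0 (Matrix.specialUnitaryGroup (Fin 2) ℂ) → ℝ),
            (∀ U, PlaqSmall (θBal F.L γ b₀ p₀ (J K)) U → 0 < ρ₁ U ∧ 0 < ρ₂ U) →
            ν K (J K) = (fieldMeasure _ _ _).withDensity (fun U => ENNReal.ofReal (ρ₁ U)) →
            ν K' (J K) = (fieldMeasure _ _ _).withDensity (fun U => ENNReal.ofReal (ρ₂ U)) →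
            ContinuousOn ρ₁ {U | PlaqSmall (θBal F.L γ b₀ p₀ (J K)) U} →
            ContinuousOn ρ₂ {U | PlaqSmall (θBal F.L γ b₀ p₀ (J K)) U} →
            ∀ (b b' : PBond (F.P (J K)) 0) (U V W Z : GaugeField (F.P (J K)) 0 (Matrix.specialUnitaryGroup (Fin 2) ℂ)),
              PlaqSmall (θBal F.L γ b₀ p₀ (J K)) U → PlaqSmall (θBal F.L γ b₀ p₀ (J K)) V →
              PlaqSmall (θBal F.L γ b₀ p₀ (J K)) W → PlaqSmall (θBal F.L γ b₀ p₀ (J K)) Z →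
              (∀ e, e ≠ b → U e = V e) → (∀ e, e ≠ b' → U e = W e) → (∀ e, e ≠ b' → V e = Z e) → (∀ e, e ≠ b → W e = Z e) →
              |(Real.log (ρ₁ U) - Real.log (ρ₂ U)) - (Real.log (ρ₁ V) - Real.log (ρ₂ V)) -
                  ((Real.log (ρ₁ W) - Real.log (ρ₂ W)) - (Real.log (ρ₁ Z) - Real.log (ρ₂ Z)))|
                ≤ σ K * Real.exp (-(κ * (b.src.tdist b'.src : ℝ))) := by
  have hα :
      ∀ (L : ℕ) (b₀ p₀ : ℝ), 0 < b₀ → 0 < p₀ → ∃ ε₁ : ℝ, 0 < ε₁ ∧ ∀ (ε₀ : ℝ), 0 < ε₀ → ε₀ ≤ ε₁ →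
        ∃ γ₁ : ℝ, 0 < γ₁ ∧ ∃ κ : ℝ, 0 < κ ∧ ∀ (F : T3Family) (γ : ℝ), F.L = L → 0 < γ → γ ≤ γ₁ →
          ∃ (P τ : ℕ → ℝ), (∀ n, 0 ≤ P n) ∧ (∀ n, 0 ≤ τ n) ∧ Antitone τ ∧ Tendsto τ atTop (𝓝 0) ∧
            ∀ (J K K' : ℕ) (hJK : J ≤ K) (hJK' : J ≤ K'), K ≤ K' →
              ∀ (b b' : PBond (F.P J) 0) (U V W Z : GaugeField (F.P J) 0 (Matrix.specialUnitaryGroup (Fin 2) ℂ)),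
                PlaqSmall (θBal F.L γ b₀ p₀ J) U → PlaqSmall (θBal F.L γ b₀ p₀ J) V →
                PlaqSmall (θBal F.L γ b₀ p₀ J) W → PlaqSmall (θBal F.L γ b₀ p₀ J) Z →
                (∀ e, e ≠ b → U e = V e) → (∀ e, e ≠ b' → U e = W e) → (∀ e, e ≠ b' → V e = Z e) → (∀ e, e ≠ b → W e = Z e) →
                |((F.scheme ℰp γ).β K * minActionRegPr F J K hJK ε₀ U - (F.scheme ℰp γ).β K' * minActionRegPr F J K' hJK' ε₀ U)
                  - ((F.scheme ℰp γ).β K * minActionRegPr F J K hJK ε₀ V - (F.scheme ℰp γ).β K' * minActionRegPr F J K' hJK' ε₀ V)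
                  - (((F.scheme ℰp γ).β K * minActionRegPr F J K hJK ε₀ W - (F.scheme ℰp γ).β K' * minActionRegPr F J K' hJK' ε₀ W)
                    - ((F.scheme ℰp γ).β K * minActionRegPr F J K hJK ε₀ Z - (F.scheme ℰp γ).β K' * minActionRegPr F J K' hJK' ε₀ Z))|
                  ≤ P J * τ (K - J) * Real.exp (-(κ * (b.src.tdist b'.src : ℝ))) := classicalTwoDepth_of_perHeight hα'
  intro L
  obtain ⟨pS, hβL⟩ := hβ L
  refine ⟨pS, fun b₀ p₀ hb₀ hpS hp₀ => ?_⟩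
  obtain ⟨εa, hεa, Ha⟩ := hα L b₀ p₀ hb₀ hp₀
  obtain ⟨εb, hεb, Hb⟩ := hβL b₀ p₀ hb₀ hpS hp₀
  obtain ⟨γa, hγa, κa, hκa, Ha⟩ := Ha (min εa εb) (lt_min hεa hεb) (min_le_left _ _)
  obtain ⟨γb, hγb, κb, hκb, Hb⟩ := Hb (min εa εb) (lt_min hεa hεb) (min_le_right _ _)
  refine ⟨min γa γb, lt_min hγa hγb, min κa κb, lt_min hκa hκb, fun F γ hFL hγ hγ1 => ?_⟩
  obtain ⟨P, τ, hP0, hτ0, hτa, hτt, HA⟩ := Ha F γ hFL hγ (hγ1.trans (min_le_left _ _))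
  obtain ⟨φ, hφ0, hφt, HB⟩ := Hb F γ hFL hγ (hγ1.trans (min_le_right _ _))
  obtain ⟨J, hJlt, hJle, hJ, hprod⟩ := diagonalScheduleStrict P τ hP0 hτ0 hτa hτt
  -- the seed's σ
  have hφJ : Tendsto (fun K => (J K : ℝ) * φ (J K)) atTop (𝓝 0) := hφt.comp hJ
  have hJ1 : ∀ᶠ K in atTop, 1 ≤ J K := (tendsto_atTop.1 hJ) 1
  have hPτ : Tendsto (fun K => P (J K) * τ (K - J K)) atTop (𝓝 0) := by
    refine squeeze_zero' (Eventually.of_forall fun K => mul_nonneg (hP0 _) (hτ0 _)) ?_ hprod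
    filter_upwards [hJ1] with K hK
    have h1 : (1 : ℝ) ≤ J K := by exact_mod_cast hK
    have : P (J K) * τ (K - J K) ≤ (P (J K) + 1) * τ (K - J K) :=
      mul_le_mul_of_nonneg_right (by linarith) (hτ0 _)
    calc P (J K) * τ (K - J K) ≤ (P (J K) + 1) * τ (K - J K) := this
      _ = 1 * ((P (J K) + 1) * τ (K - J K)) := (one_mul _).symm
      _ ≤ (J K : ℝ) * ((P (J K) + 1) * τ (K - J K)) :=
          mul_le_mul_of_nonneg_right h1 (mul_nonneg (by linarith [hP0 (J K)]) (hτ0 _))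
      _ = (J K : ℝ) * (P (J K) + 1) * τ (K - J K) := by ring
  have hφ' : Tendsto (fun K => φ (J K)) atTop (𝓝 0) := by
    refine squeeze_zero' (Eventually.of_forall fun K => hφ0 _) ?_ hφJ
    filter_upwards [hJ1] with K hK
    have h1 : (1 : ℝ) ≤ J K := by exact_mod_cast hK
    calc φ (J K) = 1 * φ (J K) := (one_mul _).symm
      _ ≤ (J K : ℝ) * φ (J K) := mul_le_mul_of_nonneg_right h1 (hφ0 _)
  refine ⟨J, fun K => P (J K) * τ (K - J K) + 2 * φ (J K), hJlt, hJle, hJ,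
    fun K => add_nonneg (mul_nonneg (hP0 _) (hτ0 _)) (mul_nonneg zero_le_two (hφ0 _)), ?_, ?_, ?_⟩
  · simpa using hPτ.add (hφ'.const_mul 2)
  · have : Tendsto (fun K => (J K : ℝ) * (P (J K) + 1) * τ (K - J K) + 2 * ((J K : ℝ) * φ (J K))) atTop (𝓝 0) := by
      simpa using hprod.add (hφJ.const_mul 2)
    refine squeeze_zero' (Eventually.of_forall fun K => mul_nonneg (Nat.cast_nonneg _)
      (add_nonneg (mul_nonneg (hP0 _) (hτ0 _)) (mul_nonneg zero_le_two (hφ0 _)))) (Eventually.of_forall fun K => ?_) this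
    have hJK0 : (0 : ℝ) ≤ J K := Nat.cast_nonneg _
    have : (J K : ℝ) * (P (J K) * τ (K - J K)) ≤ (J K : ℝ) * ((P (J K) + 1) * τ (K - J K)) :=
      mul_le_mul_of_nonneg_left (mul_le_mul_of_nonneg_right (by linarith) (hτ0 _)) hJK0
    nlinarith [this]
  · intro ν hν1 hν2 K K' hKK' ρ₁ ρ₂ hpos hd₁ hd₂ hc₁ hc₂ b b' U V W Z hU hV hW hZ h1 h2 h3 h4
    have hJK : J K ≤ K := hJle K
    have hJK' : J K ≤ K' := hJK.trans hKK'
    have HAx := HA (J K) K K' hJK hJK' hKK' b b' U V W Z hU hV hW hZ h1 h2 h3 h4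
    have HB1 := HB ν hν1 hν2 (J K) K hJK ρ₁ (fun U hU => (hpos U hU).1) hd₁ hc₁ b b' U V W Z hU hV hW hZ h1 h2 h3 h4
    have HB2 := HB ν hν1 hν2 (J K) K' hJK' ρ₂ (fun U hU => (hpos U hU).2) hd₂ hc₂ b b' U V W Z hU hV hW hZ h1 h2 h3 h4
    -- clustering factors: κ := min κa κb
    have hd0 : (0 : ℝ) ≤ (b.src.tdist b'.src : ℝ) := Nat.cast_nonneg _
    have hea : Real.exp (-(κa * (b.src.tdist b'.src : ℝ))) ≤ Real.exp (-(min κa κb * (b.src.tdist b'.src : ℝ))) :=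
      Real.exp_le_exp.2 (neg_le_neg (mul_le_mul_of_nonneg_right (min_le_left _ _) hd0))
    have heb : Real.exp (-(κb * (b.src.tdist b'.src : ℝ))) ≤ Real.exp (-(min κa κb * (b.src.tdist b'.src : ℝ))) :=
      Real.exp_le_exp.2 (neg_le_neg (mul_le_mul_of_nonneg_right (min_le_right _ _) hd0))
    set E := Real.exp (-(min κa κb * (b.src.tdist b'.src : ℝ))) with hE
    set βK := (F.scheme ℰp γ).β K
    set βK' := (F.scheme ℰp γ).β K'
    set mU := minActionRegPr F (J K) K hJK (min εa εb) U
    set mV := minActionRegPr F (J K) K hJK (min εa εb) V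
    set mW := minActionRegPr F (J K) K hJK (min εa εb) W
    set mZ := minActionRegPr F (J K) K hJK (min εa εb) Z
    set nU := minActionRegPr F (J K) K' hJK' (min εa εb) U
    set nV := minActionRegPr F (J K) K' hJK' (min εa εb) V
    set nW := minActionRegPr F (J K) K' hJK' (min εa εb) W
    set nZ := minActionRegPr F (J K) K' hJK' (min εa εb) Z
    have hA : |(βK * mU - βK' * nU) - (βK * mV - βK' * nV) - ((βK * mW - βK' * nW) - (βK * mZ - βK' * nZ))|
        ≤ P (J K) * τ (K - J K) * E :=
      HAx.trans (mul_le_mul_of_nonneg_left hea (mul_nonneg (hP0 _) (hτ0 _)))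
    have hB1 : |((Real.log (ρ₁ U) + βK * mU) - (Real.log (ρ₁ V) + βK * mV))
        - ((Real.log (ρ₁ W) + βK * mW) - (Real.log (ρ₁ Z) + βK * mZ))| ≤ φ (J K) * E :=
      HB1.trans (mul_le_mul_of_nonneg_left heb (hφ0 _))
    have hB2 : |((Real.log (ρ₂ U) + βK' * nU) - (Real.log (ρ₂ V) + βK' * nV))
        - ((Real.log (ρ₂ W) + βK' * nW) - (Real.log (ρ₂ Z) + βK' * nZ))| ≤ φ (J K) * E :=
      HB2.trans (mul_le_mul_of_nonneg_left heb (hφ0 _))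
    have key : (Real.log (ρ₁ U) - Real.log (ρ₂ U)) - (Real.log (ρ₁ V) - Real.log (ρ₂ V)) -
        ((Real.log (ρ₁ W) - Real.log (ρ₂ W)) - (Real.log (ρ₁ Z) - Real.log (ρ₂ Z)))
        = (((Real.log (ρ₁ U) + βK * mU) - (Real.log (ρ₁ V) + βK * mV))
            - ((Real.log (ρ₁ W) + βK * mW) - (Real.log (ρ₁ Z) + βK * mZ)))
          - (((Real.log (ρ₂ U) + βK' * nU) - (Real.log (ρ₂ V) + βK' * nV))
            - ((Real.log (ρ₂ W) + βK' * nW) - (Real.log (ρ₂ Z) + βK' * nZ)))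
          - ((βK * mU - βK' * nU) - (βK * mV - βK' * nV) - ((βK * mW - βK' * nW) - (βK * mZ - βK' * nZ))) := by ring
    rw [key]
    calc _ ≤ |(((Real.log (ρ₁ U) + βK * mU) - (Real.log (ρ₁ V) + βK * mV))
            - ((Real.log (ρ₁ W) + βK * mW) - (Real.log (ρ₁ Z) + βK * mZ)))
          - (((Real.log (ρ₂ U) + βK' * nU) - (Real.log (ρ₂ V) + βK' * nV))
            - ((Real.log (ρ₂ W) + βK' * nW) - (Real.log (ρ₂ Z) + βK' * nZ)))|
          + |(βK * mU - βK' * nU) - (βK * mV - βK' * nV) - ((βK * mW - βK' * nW) - (βK * mZ - βK' * nZ))| := abs_sub _ _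
      _ ≤ (|((Real.log (ρ₁ U) + βK * mU) - (Real.log (ρ₁ V) + βK * mV))
            - ((Real.log (ρ₁ W) + βK * mW) - (Real.log (ρ₁ Z) + βK * mZ))|
          + |((Real.log (ρ₂ U) + βK' * nU) - (Real.log (ρ₂ V) + βK' * nV))
            - ((Real.log (ρ₂ W) + βK' * nW) - (Real.log (ρ₂ Z) + βK' * nZ))|)
          + |(βK * mU - βK' * nU) - (βK * mV - βK' * nV) - ((βK * mW - βK' * nW) - (βK * mZ - βK' * nZ))| :=
          add_le_add_left (abs_sub _ _) _
      _ ≤ (φ (J K) * E + φ (J K) * E) + P (J K) * τ (K - J K) * E := add_le_add (add_le_add hB1 hB2) hA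
      _ = (P (J K) * τ (K - J K) + 2 * φ (J K)) * E := by ring

end Summit.QuantumFields.YangMills.Theorems.FluctuationComparisonRegPrIntL.RunPairOrgan
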